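import Literature.Topology.FourManifolds.BordismFourDuality
import Literature.AlgebraicTopology.SingularHomology.LefschetzDualityProofs
import HarnessLib

/-!
# Thom (1952) Thm V.10 and Cor. V.11 in dimension four — discharge
(`Literature.Topology.FourManifolds.signature_eq_zero_of_isOrientedBordant_of_isEmpty_holds`)

Sibling proof file of `Literature.Topology.FourManifolds.BordismFourProofs` (where the two named
facts live) and of `Literature.Topology.FourManifolds.BordismFourDuality` (which reduced them to
Lefschetz duality alone).  R. Thom, *Espaces fibrés en sphères et carrés de Steenrod*, Ann. Sci.
ENS 69 (1952), Ch. V §IV, p. 176: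

* **Thm V.10** — "Pour qu'une variété orientée de dimension `4k` soit une variété-bord, il faut que
  la forme quadratique définie par le cup-produit sur `H^{2k}` admette pour indice d'inertie
  `½ b^{2k}(V)`";
* **Cor. V.11** — "Pour qu'une variété orientée `V` de dimension `4k` soit une variété-bord, il faut
  que l'index de la forme quadratique définie par le cup-produit sur la cohomologie réelle de
  dimension `2k` soit nul";

here `k = 1`, for the homological notion of oriented boundary of the statement file
(`IsOrientedBordant 4 π ν` with an empty second end — Thom's "variété-bord", p. 175: `V = ∂M`,
`M` compact orientable, `∂m = v`).

The tree proves Thom's printed route — Thm V.7 + Cor. V.8 (p. 173: `Aᵖ = f^* Hᵖ(M)` and `A^{n−p}`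
are mutual annihilators, `r_p + r_{n−p} = b_p(V)`) ⟹ Thm V.10 ⟹ Cor. V.11 ("l'indice d'inertie
est égal à `Inf(p, b − p)`") — applied to the whole boundary of a cobordism
(`BordismFourProofs.lean`, …, `BordismFourDuality.lean`), down to Lefschetz duality for compact
5-manifolds with boundary (`signature_eq_zero_of_isOrientedBordant_of_isEmpty_of_lefschetz`,
`exists_isotropic_of_isOrientedBordant_of_isEmpty_of_lefschetz`; Poincaré duality of the closed
ends being the theorem `poincare_duality`).  Lefschetz duality is now a theorem of `Literature` in
every universe (`bijective_relCapProduct_of_isRelFundamentalClass_holds`,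
`…SingularHomology.LefschetzDualityProofs`: external collar + Miller's Thm. 37.1), so both facts
are DISCHARGED:

* `exists_isotropic_of_isOrientedBordant_of_isEmpty_holds` — Thm V.10 (`k = 1`);
* `signature_eq_zero_of_isOrientedBordant_of_isEmpty_holds` — Cor. V.11 (`k = 1`).

No hypotheses remain; no named facts are introduced.

## References

* R. Thom, Ann. Sci. ENS 69 (1952), Ch. V: Thm V.7, Cor. V.8 (p. 173), definition of
  "variété-bord" (p. 175), Thm V.10, Cor. V.11 (p. 176). [Thom1952]
* R. Thom, Comment. Math. Helv. 28 (1954), Ch. IV §2 (p. 65: Thm IV.1 from "théorème V.11 de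
  [27]"). [ThomCMH1954]
* E. H. Spanier, *Algebraic Topology*, Springer 1981, Ch. 6 §3 Thm. 12. [Spanier1981]
* A. Hatcher, *Algebraic Topology*, CUP 2002, Thm. 3.30, Thm. 3.43. [Hatcher2002]
-/

noncomputable section

open scoped Manifold ContDiff Topology

universe u

namespace Literature.Topology.FourManifolds

section SPC4

/-- **Thom (1952), Thm V.10, in dimension four — DISCHARGED.**  If a closed smooth `ℤ`-oriented
4-manifold `(P, π)` is an oriented boundary (`IsOrientedBordant 4 π ν` with `N` empty), then
`H²(P; ℤ)/T` contains a submodule of half rank on which `x ↦ Q_P(x, x)` vanishes identically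
(Thom, Ann. Sci. ENS 69 (1952), p. 176; the witness is `A² = i^* H²(W)`, isotropic by Thm V.7 and
of half rank by Cor. V.8).  From `exists_isotropic_of_isOrientedBordant_of_isEmpty_of_lefschetz`
(`BordismFourDuality.lean`) and Lefschetz duality in every universe
(`bijective_relCapProduct_of_isRelFundamentalClass_holds`).  PROVED, no hypotheses.
[cite: Thom1952, Thm V.10 (p. 176)] -/
theorem exists_isotropic_of_isOrientedBordant_of_isEmpty_holds :
    exists_isotropic_of_isOrientedBordant_of_isEmpty.{u} :=
  exists_isotropic_of_isOrientedBordant_of_isEmpty_of_lefschetz (fun {W} _ _ _ _ z hz =>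
    Literature.AlgebraicTopology.SingularHomology.bijective_relCapProduct_of_isRelFundamentalClass_holds
      4 W z hz (show 2 + (2 + 1) = 4 + 1 by rfl))

/-- **Thom (1952), Cor. V.11, in dimension four — DISCHARGED: the signature of an oriented
boundary vanishes.**  For closed smooth `ℤ`-oriented 4-manifolds `P` and `N` with `N` empty,
`IsOrientedBordant 4 π ν → σ(P, π) = 0` (Thom, Ann. Sci. ENS 69 (1952), Cor. V.11, p. 176, quoted
as "théorème V.11 de [27]" in Thom, Comment. Math. Helv. 28 (1954), Ch. IV §2, p. 65; also Kirby,
LNM 1374 (1989), II §5 Thm 5.2).  From `signature_eq_zero_of_isOrientedBordant_of_isEmpty_of_lefschetz`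
(`BordismFourDuality.lean`: Thom's route Thm V.7 + Cor. V.8 ⟹ Thm V.10 ⟹ Cor. V.11 with
Poincaré duality of the closed ends fed by `poincare_duality`) and Lefschetz duality in every
universe (`bijective_relCapProduct_of_isRelFundamentalClass_holds`, Spanier Thm. 6.3.12).
PROVED, no hypotheses. [cite: Thom1952, Cor. V.11 (p. 176)] -/
theorem signature_eq_zero_of_isOrientedBordant_of_isEmpty_holds :
    signature_eq_zero_of_isOrientedBordant_of_isEmpty.{u} :=
  signature_eq_zero_of_isOrientedBordant_of_isEmpty_of_lefschetz (fun {W} _ _ _ _ z hz =>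
    Literature.AlgebraicTopology.SingularHomology.bijective_relCapProduct_of_isRelFundamentalClass_holds
      4 W z hz (show 2 + (2 + 1) = 4 + 1 by rfl))

end SPC4

end Literature.Topology.FourManifolds

end
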